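import Summits.BirchSwinnertonDyer.BirchSwinnertonDyer.Theorems.ByReductionTypeAtTwoMultTransportFrobenius
import Summits.BirchSwinnertonDyer.Rank1Residual.X2.GreenbergVatsalTateDatumCofree
import Summits.BirchSwinnertonDyer.Rank1Residual.X2.GreenbergVatsalStrictAtNonsplit
import Literature.NumberTheory.EllipticCurves.Greenberg1999.KummerImageMultiplicative
import HarnessLib

/-!
# T-42-mult in the kernel, I-b: the Tate datum of `E/ℚ` at a MULTIPLICATIVE `2` over the cyclotomic
# `ℤ₂`-tower — the inertia-form and the strict local condition COINCIDE at a non-split `2`, and the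
# package of local properties of the Tate datum at `2`

Cell `bsd-2adic` (run/shared/lean/pub/bsd-2adic/), seat `bsd-2adic-t42` (BRIEF-T42, DESIGN-T42 §5 items
T1/T2/T4): the `p = 2` ports of b2b's `X2.GreenbergVatsalStrictAtNonsplit` and of the package
`X2.GreenbergVatsalTateDatumCofree.exists_data_of_not_split`, toward the kernel theorem discharging
`X5.O1.MultCongruenceTransportAtTwo` (Matsuno's method at a multiplicative `2`). HONEST FRAMING: research
route; theorems only (no `def`, no new named fact, nothing booked); the one PUBLISHED input consumed BY
NAME is Greenberg's Prop. 2.4 at a multiplicative prime over the cyclotomic tower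
(`Greenberg1999.imKummer_ge_strictCondition_multiplicative_cyclotomic`, hypothesis `hF2`).

WHAT THIS FILE PROVES (`E/ℚ` globally minimal, MULTIPLICATIVE at `2`, `v ∋ 2`, a twisted Tate
parametrisation `(q, t, Ψ)` with `t² = γ = −c₄/c₆` as delivered by
`Silverman1994_thmV53_corV54_tateUniformisation`).
* §2 `equivariant_of_mem_absInertia_two`, `smul_gr_eq_of_mem_inertia_tate_two`,
  `exists_smul_sub_eq_of_apply_ne_two` (at `p = 2` the quotient `D = E[2^∞]/C` is `2`-divisible, so
  `Frob − 1 = −2` is onto WITHOUT the odd-`p` halving), and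
  **`greenbergKer_eq_strictKer_tate_of_flip_two`**: over `ℚ_∞ = ℚ̄^{ker κ}` (`κ` cyclotomic) the
  inertia-form condition `ker(H¹ → H¹(I, E[2^∞]/C))` and the strict condition
  `ker(H¹ → H¹(D, E[2^∞]/C))` of the Tate datum COINCIDE at a non-split `2` (b2b's proof with its
  three odd-`p` inputs replaced; the flip is file I-a's `frob_apply_sqrt_gamma_ne_two`).
* §3 **`tateDatum_package_two`** (any multiplicative `2`): `htriv` (inertia trivial on `D`), `C`
  divisible with `#(C ∩ E[2]) = 2`, `localKerOver ≤ greenbergKer`;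
  **`strictKer_le_localKerOver_tate_two`** = Greenberg's Prop. 2.4 at a multiplicative prime over the
  cyclotomic tower (`hF2`, PRINT, any `p`) read on the Tate datum;
  **`tateDatum_kernels_of_not_split_two`**: at a non-split `2`,
  `localKerOver = greenbergKer = strictKer` over `ℚ_∞` (the true Kummer condition IS the datum's).

References: [GreenbergLNM1716] §2 Prop. 2.4 and p. 82; [SilvermanATAEC1994] V.5.2–5.4, Ex. 5.11;
[GreenbergVatsal2000] §2 pp. 14–16 (odd `p` original); [Matsuno2008] §4 (the method at `p = 2`).
-/

set_option autoImplicit false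

set_option linter.dupNamespace false

noncomputable section

open scoped Classical AddSubgroup NNReal

universe u

namespace Summit.BirchSwinnertonDyer.BirchSwinnertonDyer.Theorems.MultTransportAtTwo

open NumberField IsDedekindDomain Field Polynomial Literature.NumberTheory.GaloisRepresentations
  Literature.NumberTheory.EllipticCurves Literature.NumberTheory.EllipticCurves.GreenbergSelmer
  Literature.NumberTheory.EllipticCurves.GreenbergVatsal2000
  Literature.NumberTheory.EllipticCurves.Greenberg1999
  Literature.NumberTheory.EllipticCurves.ResKernel IsDedekindDomain.HeightOneSpectrum
  Rat.HeightOneSpectrum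
  Summit.BirchSwinnertonDyer.Rank1Residual
  Summit.BirchSwinnertonDyer.Rank1Residual.X2
  Summit.BirchSwinnertonDyer.Rank1Residual.X2.GreenbergVatsalTorsion
  Summit.BirchSwinnertonDyer.Rank1Residual.X2.GreenbergVatsalTateDatum
  Summit.BirchSwinnertonDyer.Rank1Residual.X2.GreenbergVatsalTateDatumSign
  Summit.BirchSwinnertonDyer.Rank1Residual.X2.GreenbergVatsalTateDatumTorsion
  Summit.BirchSwinnertonDyer.Rank1Residual.X2.GreenbergVatsalStrictCore
  Summit.BirchSwinnertonDyer.Rank1Residual.X2.GreenbergVatsalStrictAtPQuotient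
  Summit.BirchSwinnertonDyer.Rank1Residual.X2.GreenbergVatsalStrictSelmer
  Summit.BirchSwinnertonDyer.Rank1Residual.X2.GreenbergVatsalTateKummer
  Summit.BirchSwinnertonDyer.Rank1Residual.X2.GreenbergVatsalTateDatumCofree
  Summit.BirchSwinnertonDyer.Rank1Residual.X2.GreenbergVatsalReductionDatum
  Summit.BirchSwinnertonDyer.Rank1Residual.X2.GreenbergVatsalStrictSelmerMultiplicative
open WeierstrassCurve (minimalDiscriminantInt integralModelInt)

/-! ## §2. `greenbergKer = strictKer` for the Tate datum at a non-split multiplicative `2` -/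

section Main

variable (W : WeierstrassCurve ℚ) [W.IsGloballyMinimal] [W.IsElliptic]
  (κ : ZpExtension ℚ 2) {v : HeightOneSpectrum (𝓞 ℚ)}
  (Ψ : Additive (AlgebraicClosure (v.adicCompletion ℚ))ˣ →+ localPoints W (v.adicCompletion ℚ))
  (t : AlgebraicClosure (v.adicCompletion ℚ))
  (hΨσ : ∀ (σ : absoluteGaloisGroup (v.adicCompletion ℚ))
      (u : (AlgebraicClosure (v.adicCompletion ℚ))ˣ),
    σ • Ψ (Additive.ofMul u) =
      (if Field.absoluteGaloisGroup.toAlgEquiv (v.adicCompletion ℚ) σ t = t then (1 : ℤ)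
        else -1) •
      Ψ (Additive.ofMul (Units.map
        (Field.absoluteGaloisGroup.toAlgEquiv (v.adicCompletion ℚ) σ :
          AlgebraicClosure (v.adicCompletion ℚ) →* AlgebraicClosure (v.adicCompletion ℚ)) u)))
  (hsurj : Function.Surjective Ψ) {q : v.adicCompletion ℚ}
  (hker : ∀ u : (AlgebraicClosure (v.adicCompletion ℚ))ˣ, Ψ (Additive.ofMul u) = 0 →
    ∃ a : ℤ, (u : AlgebraicClosure (v.adicCompletion ℚ)) =
      algebraMap (v.adicCompletion ℚ) (AlgebraicClosure (v.adicCompletion ℚ)) q ^ a)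
  (ht0 : t ≠ 0)
  (ht2 : t ^ 2 = algebraMap (v.adicCompletion ℚ) (AlgebraicClosure (v.adicCompletion ℚ))
    (algebraMap ℚ (v.adicCompletion ℚ) (-(W.c₄ / W.c₆))))

include hΨσ ht2 in
/-- The inertial equivariance of a twisted Tate parametrisation at a multiplicative `2`: for
`σ ∈ absInertia ℚ₂`, `σ • Ψ(u) = Ψ(σ u)` (the sign `χ(σ) = σ(t)/t` is `+1` on inertia,
`absInertia_fix_sqrt_gamma_two`). [cite: SilvermanATAEC1994, Ch. V Lemma 5.2 (c), Thm. 5.3 (a),(b), Cor. 5.4] -/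
theorem equivariant_of_mem_absInertia_two (hmult : W.HasMultiplicativeReductionAtPrime 2)
    (h2v : ((2 : ℕ) : 𝓞 ℚ) ∈ v.asIdeal) :
    ∀ σ ∈ absInertia (v.adicCompletion ℚ), ∀ u : (AlgebraicClosure (v.adicCompletion ℚ))ˣ,
      σ • Ψ (Additive.ofMul u) = Ψ (Additive.ofMul (Units.map
        (Field.absoluteGaloisGroup.toAlgEquiv (v.adicCompletion ℚ) σ :
          AlgebraicClosure (v.adicCompletion ℚ) →* AlgebraicClosure (v.adicCompletion ℚ)) u)) := by
  intro σ hσ u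
  rw [hΨσ σ u, if_pos (absInertia_fix_sqrt_gamma_two W hmult h2v t ht2 σ hσ), one_zsmul]

include hsurj hker ht2 in
/-- At a multiplicative `2`, **inertia acts trivially on `D = E[2^∞]/C`** for the Tate datum of a
twisted parametrisation (b2b's `tateDatum_htriv`, with the inertial equivariance from
`absInertia_fix_sqrt_gamma_two`). [cite: GreenbergVatsal2000, §2 pp. 14–15]
[cite: SilvermanATAEC1994, Ch. V Lemma 5.2 (c), Thm. 5.3 (a),(b), Cor. 5.4] -/
theorem smul_gr_eq_of_mem_inertia_tate_two (hmult : W.HasMultiplicativeReductionAtPrime 2)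
    (h2v : ((2 : ℕ) : 𝓞 ℚ) ∈ v.asIdeal) {i : decomp (K := ℚ) v}
    (hi : (i : absoluteGaloisGroup ℚ) ∈ inertia v)
    (d : (tateDatum W 2 Ψ (sign_disj W Ψ t hΨσ)).Gr) : i • d = d := by
  obtain ⟨m, rfl⟩ := (tateDatum W 2 Ψ (sign_disj W Ψ t hΨσ)).grMk_surjective d
  rw [LocalDatum.smul_grMk, grMk_eq_grMk_iff]
  exact tateDatum_htriv W 2 Ψ (sign_disj W Ψ t hΨσ) hsurj hker
    (equivariant_of_mem_absInertia_two W Ψ t hΨσ ht2 hmult h2v) _ hi m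

omit [W.IsGloballyMinimal] in
include hsurj hker in
/-- **`res σ − 1` is SURJECTIVE on `D` when `σt ≠ t`, at `p = 2`**: `res σ` acts as `−1` on `D`
(b2b's `smul_gr_eq_neg_of_apply_ne`), and `D = E[2^∞]/C` is `2`-divisible (`divisible_gr` at
`p = 2`), so `d = (res σ − 1)(−d')` for `2 • d' = d` — no odd-`p` halving needed.
[cite: GreenbergVatsal2000, §2 p. 15] -/
theorem exists_smul_sub_eq_of_apply_ne_two {σ : absoluteGaloisGroup (v.adicCompletion ℚ)}
    (hσ : Field.absoluteGaloisGroup.toAlgEquiv (v.adicCompletion ℚ) σ t ≠ t)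
    (d : (tateDatum W 2 Ψ (sign_disj W Ψ t hΨσ)).Gr) :
    ∃ d' : (tateDatum W 2 Ψ (sign_disj W Ψ t hΨσ)).Gr,
      (⟨absGaloisRestrict ℚ (v.adicCompletion ℚ) σ, ⟨σ, rfl⟩⟩ : decomp (K := ℚ) v) • d' - d' = d := by
  obtain ⟨e, he⟩ := divisible_gr W 2 (tateDatum W 2 Ψ (sign_disj W Ψ t hΨσ)) d
  refine ⟨-e, ?_⟩
  rw [smul_neg, smul_gr_eq_neg_of_apply_ne W 2 Ψ t hΨσ hsurj hker hσ e, neg_neg, sub_neg_eq_add,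
    ← two_nsmul, he]

include hsurj hker ht0 ht2 in
/-- **At a NON-SPLIT multiplicative `2`, the INERTIA-form condition implies the STRICT condition over
`ℚ_∞^{cyc}` for the Tate datum: `greenbergKer ≤ strictKer`** — b2b's odd-`p` argument
(`X2.GreenbergVatsalStrictAtNonsplit.greenbergKer_le_strictKer_tate_of_flip`) with its three odd-`p`
inputs replaced: the arithmetic Frobenius in `Gal(ℚ̄₂/ℚ_{∞,𝔭})` flips `t`
(`frob_apply_sqrt_gamma_ne_two`), `Frob − 1 = −2` is onto the `2`-divisible `D`
(`exists_smul_sub_eq_of_apply_ne_two`), inertia acts trivially on `D`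
(`smul_gr_eq_of_mem_inertia_tate_two`); the group-theoretic core
(`exists_eq_smul_sub_of_vanishing_on_inertia_of_surjective`, "inertia fills the layers") is
prime-generic. [cite: GreenbergVatsal2000, §2 pp. 14–16] [cite: GreenbergLNM1716, §2 pp. 73–76] -/
theorem greenbergKer_le_strictKer_tate_of_flip_two (hκ : κ.IsCyclotomic)
    (hmult : W.HasMultiplicativeReductionAtPrime 2) (hns : ¬ W.HasSplitMultiplicativeReductionAtPrime 2)
    (h2v : ((2 : ℕ) : 𝓞 ℚ) ∈ v.asIdeal) :
    (tateDatum W 2 Ψ (sign_disj W Ψ t hΨσ)).greenbergKer κ.kerSubgroup ≤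
      (tateDatum W 2 Ψ (sign_disj W Ψ t hΨσ)).strictKer κ.kerSubgroup := by
  set N := tateDatum W 2 Ψ (sign_disj W Ψ t hΨσ) with hN
  intro c hc
  obtain ⟨f, rfl⟩ :=
    oneCocycleClass_surjective (discreteTopRep κ.kerSubgroup (W.geomPrimaryTorsion 2)) c
  obtain ⟨q₀, hq₀⟩ := (GreenbergVatsalSelmerLink.oneCocycleClass_mem_greenbergKer_iff κ.kerSubgroup _
    N f).1 hc
  rw [LocalDatum.mem_strictKer_iff, LocalDatum.strictMap, resH1Hom_oneCocycleClass,
    oneCocycleClass_eq_zero_iff]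
  -- the local Frobenius inside `H`, flipping `t`
  obtain ⟨𝔐, h𝔐⟩ := v.localPrimesAbove_nonempty
  have hϖ := IsDedekindDomain.HeightOneSpectrum.irreducible_natCast_adicCompletionIntegers_rat h2v
  obtain ⟨τ, hτ, hτH⟩ := hκ.exists_isArithFrobAt_resGal_mem_kerSubgroup (specVal_spec v) h𝔐 h2v hϖ
  have hflip : Field.absoluteGaloisGroup.toAlgEquiv (v.adicCompletion ℚ) τ t ≠ t :=
    frob_apply_sqrt_gamma_ne_two W hmult hns h2v h𝔐 hτ t ht0 ht2
  set φ₀ : decomp (K := ℚ) v := ⟨absGaloisRestrict ℚ (v.adicCompletion ℚ) τ, ⟨τ, rfl⟩⟩ with hφ₀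
  have hφ₀P : φ₀ ∈ decompIn κ.kerSubgroup v := by
    rw [mem_decompIn_iff]
    change absGaloisRestrict ℚ (v.adicCompletion ℚ) τ ∈ κ.kerSubgroup
    rw [← WeierstrassCurve.resGal_eq_absGaloisRestrict]; exact hτH
  -- dictionaries
  have hDeq : decomp v = (adicCompletionPrime ℚ v).decompositionSubgroup (absoluteGaloisGroup ℚ) :=
    (decompositionSubgroup_adicCompletionPrime_eq_range ℚ v).symm
  have hIeq : inertia v = (adicCompletionPrime ℚ v).inertia (absoluteGaloisGroup ℚ) :=
    (inertia_adicCompletionPrime_eq_map_absInertia ℚ v).symm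
  haveI := compactSpace_decomp (K := ℚ) v
  obtain ⟨b, hb⟩ := exists_eq_smul_sub_of_vanishing_on_inertia_of_surjective
    (G := decomp (K := ℚ) v) (D := N.Gr) (p := 2)
    (I := (inertia v).subgroupOf (decomp v)) (P := decompIn κ.kerSubgroup v)
    (fun g i hi ↦ by
      rw [Subgroup.mem_subgroupOf] at hi ⊢
      simp only [Subgroup.coe_mul, Subgroup.coe_inv]
      rw [hIeq] at hi ⊢
      exact GreenbergVatsalUnramifiedAway.conj_mem_inertia_of_mem_decompositionSubgroup _
        (hDeq ▸ g.2) hi)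
    hφ₀P
    (fun U hU d ↦ by
      obtain ⟨n, i, u, hi, hu, hd⟩ := exists_eq_frob_pow_mul_of_decomp v (specVal_spec v) h𝔐 hτ U hU d
      exact ⟨n, i, u, (Subgroup.mem_subgroupOf).2 hi, hu, hd⟩)
    (κ.toContinuousMonoidHom.toMonoidHom.comp (decomp v).subtype)
    (fun {x} ↦ by
      rw [mem_decompIn_iff, ZpExtension.mem_kerSubgroup]; rfl)
    (fun U hUn hU ↦ by
      haveI := hUn
      obtain ⟨B, hB⟩ := exists_layer_le_kappa_inertia κ v hκ h2v U hU
      refine ⟨B, fun u hu ↦ ?_⟩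
      obtain ⟨w, hwU, hwI, hκw⟩ := hB u hu
      exact ⟨w, hwU, (Subgroup.mem_subgroupOf).2 hwI, hκw⟩)
    (fun B ↦ exists_open_layer κ v B)
    (continuous_smul_gr W 2 N)
    (fun i hi d ↦ smul_gr_eq_of_mem_inertia_tate_two W Ψ t hΨσ hsurj hker ht2 hmult h2v
      ((Subgroup.mem_subgroupOf).1 hi) d)
    (exists_smul_sub_eq_of_apply_ne_two W Ψ t hΨσ hsurj hker hflip)
    (contOneCocycles.pullback (decompInToH κ.kerSubgroup v)
      (resHomOfEquivariant _ N.grMk fun _ _ ↦ rfl) f)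
    (fun x hxI ↦ by
      rw [contOneCocycles.pullback_apply]
      have hxH : ((x : decomp (K := ℚ) v) : absoluteGaloisGroup ℚ) ∈ κ.kerSubgroup :=
        (mem_decompIn_iff κ.kerSubgroup v _).1 x.2
      set x' : inertiaIn κ.kerSubgroup v := ⟨(x : decomp (K := ℚ) v),
        (mem_inertiaIn_iff κ.kerSubgroup v _).2 ⟨hxH, (Subgroup.mem_subgroupOf).1 hxI⟩⟩ with hx'
      have h := hq₀ x'
      have e1 : inertiaInToH κ.kerSubgroup v x' = decompInToH κ.kerSubgroup v x := Subtype.ext rfl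
      have e2 : x' • q₀ - q₀ = 0 := by
        rw [sub_eq_zero, Subgroup.smul_def]
        exact smul_gr_eq_of_mem_inertia_tate_two W Ψ t hΨσ hsurj hker ht2 hmult h2v
          ((Subgroup.mem_subgroupOf).1 hxI) q₀
      rw [e1, e2] at h
      exact h)
  exact ⟨b, fun x ↦ hb x⟩

include hsurj hker ht0 ht2 in
/-- **The two local conditions at a non-split multiplicative `2` COINCIDE over `ℚ_∞^{cyc}` for the
Tate datum**: `greenbergKer = strictKer` (`≥` is the tautology `strictKer_le_greenbergKer`).
[cite: GreenbergVatsal2000, §2 pp. 14–16] [cite: GreenbergLNM1716, §2 pp. 69–70] -/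
theorem greenbergKer_eq_strictKer_tate_of_flip_two (hκ : κ.IsCyclotomic)
    (hmult : W.HasMultiplicativeReductionAtPrime 2) (hns : ¬ W.HasSplitMultiplicativeReductionAtPrime 2)
    (h2v : ((2 : ℕ) : 𝓞 ℚ) ∈ v.asIdeal) :
    (tateDatum W 2 Ψ (sign_disj W Ψ t hΨσ)).greenbergKer κ.kerSubgroup =
      (tateDatum W 2 Ψ (sign_disj W Ψ t hΨσ)).strictKer κ.kerSubgroup :=
  le_antisymm (greenbergKer_le_strictKer_tate_of_flip_two W κ Ψ t hΨσ hsurj hker ht0 ht2 hκ hmult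
      hns h2v)
    ((tateDatum W 2 Ψ (sign_disj W Ψ t hΨσ)).strictKer_le_greenbergKer κ.kerSubgroup)

end Main

/-! ## §3. The Tate datum at a multiplicative `2`: the whole package of local properties -/

section Package

variable (W : WeierstrassCurve ℚ) [W.IsGloballyMinimal] [W.IsElliptic]
  (κ : ZpExtension ℚ 2) {v : HeightOneSpectrum (𝓞 ℚ)}
  {q : v.adicCompletion ℚ} (t : AlgebraicClosure (v.adicCompletion ℚ))
  (Ψ : Additive (AlgebraicClosure (v.adicCompletion ℚ))ˣ →+ localPoints W (v.adicCompletion ℚ))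
  (hq0 : q ≠ 0) (hq1 : Valued.v q < 1)
  (ht2 : t ^ 2 = algebraMap (v.adicCompletion ℚ) (AlgebraicClosure (v.adicCompletion ℚ))
    (algebraMap ℚ (v.adicCompletion ℚ) (-(W.c₄ / W.c₆))))
  (hsurj : Function.Surjective Ψ)
  (hker : ∀ u : (AlgebraicClosure (v.adicCompletion ℚ))ˣ, Ψ (Additive.ofMul u) = 0 ↔
    ∃ n : ℤ, (u : AlgebraicClosure (v.adicCompletion ℚ)) =
      algebraMap (v.adicCompletion ℚ) (AlgebraicClosure (v.adicCompletion ℚ)) q ^ n)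
  (hΨσ : ∀ (σ : absoluteGaloisGroup (v.adicCompletion ℚ))
      (u : (AlgebraicClosure (v.adicCompletion ℚ))ˣ),
    σ • Ψ (Additive.ofMul u) =
      (if Field.absoluteGaloisGroup.toAlgEquiv (v.adicCompletion ℚ) σ t = t then (1 : ℤ)
        else -1) •
      Ψ (Additive.ofMul (Units.map
        (Field.absoluteGaloisGroup.toAlgEquiv (v.adicCompletion ℚ) σ :
          AlgebraicClosure (v.adicCompletion ℚ) →* AlgebraicClosure (v.adicCompletion ℚ)) u)))

include ht2 in
/-- `t ≠ 0`: `γ = −c₄/c₆ ≠ 0` at a multiplicative prime (`c₄`, `c₆` are `2`-units).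
[cite: SilvermanAEC2009, VII.5 Prop. 5.1(b)] -/
theorem sqrt_gamma_ne_zero_two (hmult : W.HasMultiplicativeReductionAtPrime 2) : t ≠ 0 := by
  intro h0
  rw [h0] at ht2
  have h4 : W.c₄ = ((integralModelInt W).c₄ : ℚ) := by
    conv_lhs => rw [← WeierstrassCurve.map_integralModelInt W]
    rw [WeierstrassCurve.map_c₄, eq_intCast]
  have h6 : W.c₆ = ((integralModelInt W).c₆ : ℚ) := by
    conv_lhs => rw [← WeierstrassCurve.map_integralModelInt W]
    rw [WeierstrassCurve.map_c₆, eq_intCast]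
  obtain ⟨-, hc₄⟩ := Additive.dvd_and_not_dvd_c₄_of_hasMultiplicativeReductionAtPrime W 2 hmult
  have hc₆ := X2.GreenbergVatsalTateDatumRat.not_dvd_c₆_of_hasMultiplicativeReductionAtPrime W hmult
  have hγ0 : (-(W.c₄ / W.c₆) : ℚ) = 0 := by
    have h := ht2.symm
    rw [zero_pow two_ne_zero, ← IsScalarTower.algebraMap_apply, map_eq_zero_iff _
      (algebraMap ℚ (AlgebraicClosure (v.adicCompletion ℚ))).injective] at h
    exact h
  rw [h4, h6, neg_eq_zero, div_eq_zero_iff, Int.cast_eq_zero, Int.cast_eq_zero] at hγ0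
  rcases hγ0 with h | h
  · exact hc₄ (by rw [h]; exact dvd_zero _)
  · exact hc₆ (by rw [h]; exact dvd_zero _)

include hq0 hq1 ht2 hsurj hker in
/-- **The Tate datum `C = ι⁻¹Ψ(μ)` at a multiplicative `2` (split or not): the prime-generic
properties** — inertia acts trivially on `D = E[2^∞]/C` (`htriv`), `C` is `2`-divisible with
`#(C ∩ E[2]) = 2` (cofree of corank one), and `localKerOver ≤ greenbergKer` (the Kummer compatibility
`tateDatum_kummer` on inertia) — all b2b tree lemmas read at `p = 2`, the inertial equivariance
being `equivariant_of_mem_absInertia_two`. [cite: GreenbergVatsal2000, §2 pp. 14–16]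
[cite: SilvermanATAEC1994, Ch. V Lemma 5.2 (c), Thm. 5.3 (a),(b), Cor. 5.4] -/
theorem tateDatum_package_two (hmult : W.HasMultiplicativeReductionAtPrime 2)
    (h2v : ((2 : ℕ) : 𝓞 ℚ) ∈ v.asIdeal) :
    (∀ x ∈ inertia v, ∀ m : W.geomPrimaryTorsion 2,
        x • m - m ∈ (tateDatum W 2 Ψ (sign_disj W Ψ t hΨσ)).plus) ∧
      (∀ c ∈ (tateDatum W 2 Ψ (sign_disj W Ψ t hΨσ)).plus,
        ∃ c' ∈ (tateDatum W 2 Ψ (sign_disj W Ψ t hΨσ)).plus, 2 • c' = c) ∧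
      Nat.card ↥((tateDatum W 2 Ψ (sign_disj W Ψ t hΨσ)).plus ⊓
        (↥(W.geomPrimaryTorsion 2))[(2 : ℤ)]) = 2 ∧
      W.localKerOver 2 κ.kerSubgroup (v.adicCompletion ℚ) ≤
        (tateDatum W 2 Ψ (sign_disj W Ψ t hΨσ)).greenbergKer κ.kerSubgroup := by
  have hΨI := equivariant_of_mem_absInertia_two W Ψ t hΨσ ht2 hmult h2v
  have hker' : ∀ u : (AlgebraicClosure (v.adicCompletion ℚ))ˣ, Ψ (Additive.ofMul u) = 0 →
      ∃ a : ℤ, (u : AlgebraicClosure (v.adicCompletion ℚ)) =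
        algebraMap (v.adicCompletion ℚ) (AlgebraicClosure (v.adicCompletion ℚ)) q ^ a :=
    fun u h ↦ (hker u).1 h
  refine ⟨tateDatum_htriv W 2 Ψ _ hsurj hker' hΨI,
    tateDatum_plus_divisible W 2 Ψ _,
    ?_, ?_⟩
  · have h := natCard_tateDatum_plus_inf_torsionBy W 2 Ψ (sign_disj W Ψ t hΨσ) hq0 hq1 hker'
    exact_mod_cast h
  · exact GreenbergVatsalSelmerLink.localKerOver_le_greenbergKer W 2 κ.kerSubgroup _
      (tateDatum_kummer W 2 Ψ _ hsurj hker' hΨI hq0 hq1)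

omit [W.IsGloballyMinimal] in
include hq0 hq1 ht2 hsurj hker in
/-- **Greenberg's Prop. 2.4 at a multiplicative `2` over the cyclotomic tower, applied to the Tate
datum: `strictKer ≤ localKerOver`** — the PUBLISHED input
`Greenberg1999.imKummer_ge_strictCondition_multiplicative_cyclotomic` (hypothesis `hF2`; "Prop. 2.4
holds when `E` has multiplicative reduction", `K = (ℚ_∞)_η`, any `p`) instantiated at `p = 2` with the
Tate datum's membership criterion `mem_tateDatum_plus_iff`.
[cite: GreenbergLNM1716, Prop. 2.4 and §2 pp. 75–76, p. 82] -/
theorem strictKer_le_localKerOver_tate_two (hF2 : imKummer_ge_strictCondition_multiplicative_cyclotomic.{0})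
    (hκ : κ.IsCyclotomic) (hmult : W.HasMultiplicativeReductionAtPrime 2)
    (h2v : ((2 : ℕ) : 𝓞 ℚ) ∈ v.asIdeal) :
    (tateDatum W 2 Ψ (sign_disj W Ψ t hΨσ)).strictKer κ.kerSubgroup ≤
      W.localKerOver 2 κ.kerSubgroup (v.adicCompletion ℚ) := by
  have hv : W.HasMultiplicativeReductionAt v := hasMultiplicativeReductionAt_of_mem W 2 hmult h2v
  have hN : ∀ m : W.geomPrimaryTorsion 2, m ∈ (tateDatum W 2 Ψ (sign_disj W Ψ t hΨσ)).plus ↔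
      ∃ ζ : (AlgebraicClosure (v.adicCompletion ℚ))ˣ, IsOfFinOrder ζ ∧
        Ψ (Additive.ofMul ζ) = pointsMap W (v.adicCompletion ℚ) (m : W.geomPoints) :=
    mem_tateDatum_plus_iff _
  exact hF2 W 2 κ hκ v h2v hv q t Ψ hq0 hq1 ht2 hsurj hker hΨσ
    (tateDatum W 2 Ψ (sign_disj W Ψ t hΨσ)) hN

include hq0 hq1 ht2 hsurj hker in
/-- **NON-SPLIT multiplicative `2`: the Tate datum has `greenbergKer = strictKer` and
`localKerOver ≤ strictKer ≤ localKerOver` over `ℚ_∞`** (inertia form = strict form = the true Kummer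
condition), granted Greenberg's Prop. 2.4 at a multiplicative prime (`hF2`).
[cite: GreenbergLNM1716, Prop. 2.4 and p. 82] [cite: GreenbergVatsal2000, §2 pp. 14–16] -/
theorem tateDatum_kernels_of_not_split_two
    (hF2 : imKummer_ge_strictCondition_multiplicative_cyclotomic.{0}) (hκ : κ.IsCyclotomic)
    (hmult : W.HasMultiplicativeReductionAtPrime 2) (hns : ¬ W.HasSplitMultiplicativeReductionAtPrime 2)
    (h2v : ((2 : ℕ) : 𝓞 ℚ) ∈ v.asIdeal) :
    (tateDatum W 2 Ψ (sign_disj W Ψ t hΨσ)).greenbergKer κ.kerSubgroup =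
        (tateDatum W 2 Ψ (sign_disj W Ψ t hΨσ)).strictKer κ.kerSubgroup ∧
      W.localKerOver 2 κ.kerSubgroup (v.adicCompletion ℚ) ≤
        (tateDatum W 2 Ψ (sign_disj W Ψ t hΨσ)).strictKer κ.kerSubgroup ∧
      (tateDatum W 2 Ψ (sign_disj W Ψ t hΨσ)).strictKer κ.kerSubgroup ≤
        W.localKerOver 2 κ.kerSubgroup (v.adicCompletion ℚ) ∧
      W.localKerOver 2 κ.kerSubgroup (v.adicCompletion ℚ) =
        (tateDatum W 2 Ψ (sign_disj W Ψ t hΨσ)).greenbergKer κ.kerSubgroup := by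
  have hker' : ∀ u : (AlgebraicClosure (v.adicCompletion ℚ))ˣ, Ψ (Additive.ofMul u) = 0 →
      ∃ a : ℤ, (u : AlgebraicClosure (v.adicCompletion ℚ)) =
        algebraMap (v.adicCompletion ℚ) (AlgebraicClosure (v.adicCompletion ℚ)) q ^ a :=
    fun u h ↦ (hker u).1 h
  have heq := greenbergKer_eq_strictKer_tate_of_flip_two W κ Ψ t hΨσ hsurj hker'
    (sqrt_gamma_ne_zero_two W t ht2 hmult) ht2 hκ hmult hns h2v
  obtain ⟨-, -, -, hle⟩ := tateDatum_package_two W κ t Ψ hq0 hq1 ht2 hsurj hker hΨσ hmult h2v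
  have hge := strictKer_le_localKerOver_tate_two W κ t Ψ hq0 hq1 ht2 hsurj hker hΨσ hF2 hκ hmult h2v
  exact ⟨heq, hle.trans heq.le, hge, le_antisymm hle (heq.le.trans hge)⟩

end Package

end Summit.BirchSwinnertonDyer.BirchSwinnertonDyer.Theorems.MultTransportAtTwo

end
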